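import Summits.Ventures.GridStability.Lyapunov.WSCC9LossySlabRoa
import Literature.MathematicalPhysics.PowerSystems.LuriePostnikovSlabPositivity
import Literature.Computation.Certificates.PosSemidefDecide
import HarnessLib

/-!
# «#35-LEVEL+ (LP)» — ★ #35 «G2.c-WSCC9-LOSSY-SLAB» (lane V, γ = 2·arctan(13/200)) re-read through Lur'e–Postnikov
# POSITIVITY: the SAME exact certificate certifies an 8.57× LARGER LEVEL (`c = 7290583/2³⁰ ≈ 6.79·10⁻³` instead
# of `c_rk = 176462957398167/222684717500000000 ≈ 7.92·10⁻⁴`; radius scale ×2.93) — no solver, one file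

Cell `gridfusion` (LADDER-GRIDFUSION G2.c lossy tier, lane V PRIMARY row); seat gridfusion-lit-6 (g8); an INSTANCE of
lit-6's `Literature/MathematicalPhysics/PowerSystems/LuriePostnikovSlabPositivity.lean` (`LPSlabCertificate`,
`SlabCertificate.toLP`, `LPSlabCertificate.lt_V_of_mem_frontier_slab`) in the shape of «#45-LEVEL+ (LP)»
(`Bench/WSCC9SP9SlabLevelLP.lean`) and «#35‴-LEVEL+ (LP)» (`WSCC9LossySlab7495LevelLP.lean`). OBJECT: ★ #35's
certificate `WSCC9LossySlab.cert` (files `WSCC9LossySlab{Data,Cast,Psd,Vert1,Vert2,,Roa}.lean`; UNCHANGED). Its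
Lur'e–Postnikov function `V = xᵀPx + 2Σ λ_k ∫₀^{y_k} F_k` is minorised on the closed slab by
`xᵀ(P + Cᵀ·diag(λ_k a_k)·C)x` (`LPSlabCertificate.le_V_of_slab`; Khalil §7.1 loop transformation, Pai §4.6 (4.46)),
and the two directions `(p,q)`, `(q,p)` of a line share the face `|σ_p − σ_q| = γ`, so the LOWER MATRIX
`L = P + Cᵀ·diag(λa)·C` collects both directions' Popov terms (`λ_k a_k ∈ [0.035, 0.208]` on the six active
channels; the diagonal channels have `C_k = 0`, `λ_k = 0`). Rank-one facts against `L` — `s_k·L − C_kᵀC_k ⪰ 0` with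
the dyadic `s_k` below (nine 5 × 5 `LDLᵀ`, decided in the kernel from ★ #35's tree literals `Pq`, `lamQ`, `aQ`,
`Crow` BY NAME; no producer object) — put every level `c` with `c·s_k < γ_lo²` below `V` on the slab's faces, hence
★ #35's sentence (`WSCC9LossySlab.lossy_slab_roa`) holds VERBATIM with the level `cVLQ = 7290583/2³⁰ ≈ 6.790·10⁻³`
in place of `c_rk = cQ ≈ 7.924·10⁻⁴` (ratio 8.568; lit-6 seat arithmetic, exact rationals, re-decided below:
optimal `s_k = C_k L⁻¹ C_kᵀ ∈ {2.3504, 2.4686, 2.3607}` against `L` versus `{10.30, 21.24, 17.09}` against `P`;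
the §7 rank-one + Popov face bound of ONE direction only would give `≈ 1.38·10⁻³`, ratio 1.74).

WHAT IS DECIDED / PROVED HERE: `LloVQ` (the lower matrix over `ℚ`), `sVQ`/`sVK`, `cVLQ`; `rkV_ldl` (the nine
rank-one `LDLᵀ` facts, kernel), `levelV_tests` (kernel), `levelV_ratio` (`8 < cVLQ/c_rk`); `lowerMatrix_eq_LloVQ`
(cast plumbing), `lowerV_rankOne` (the nine PSD facts over `ℝ`), `hfrVL` (the face hypothesis at level `cVLQ`) and
`lossy_slab_roa_levelVL` (★ #35's sentence at level `cVLQ`). (★ #35's row has no upper-matrix/ball file; no ball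
sentence here.)

THREE COLUMNS. CERTIFIED (kernel): for the MODEL M′ = `WSCC9.postB_SPdamp.toModel` read in `WSCC9.lurieSystem`
(★ #35: Kron-reduced WSCC9 post-fault-B WITH transfer conductances as printed h12, printed damping
`D/M = 1/10, 1/5, 3/10`) and CLASS = ★ #35's slab + Popov certificate at the window `γ = 2·arctan(13/200)` with
the LEVEL `cVLQ` of the SAME `V`: the region sentence; inner estimate (sufficient, not sharp). VALIDATED: any
rendering in degrees (sos-2's inner-ball reading 1.67° of `c_rk` scales by `√8.568 ≈ 2.93` only as a VALIDATED
reading). MODELLED: as ★ #35 (MV-2 + MV-P + MV-SPD + MV-h12). No sentence of this file says a grid is stable.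
[cite: Khalil2002, §7.1.2 Theorem 7.3 with §7.1 Example 7.5; Pai1981, §2.16 Theorem [18] eqs. (2.63)–(2.64) and §4.6 eqs. (4.45)–(4.46); VuTuritsyn2017, §4.3 Theorem 1 with eq. (V_min)]
-/

noncomputable section

open Real Set Filter Matrix
open scoped Topology
open Literature.MathematicalPhysics.PowerSystems
open Literature.MathematicalPhysics.PowerSystems.LyapunovFunctionFamily
open Literature.Computation.Certificates
open Summit.Ventures.GridStability.Models

namespace Summit.Ventures.GridStability.Lyapunov.WSCC9LossySlab

/-! ### The new literals (all dyadic; lit-6 seat arithmetic, re-decided below) -/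

/-- Per-channel rank-one constants against the LOWER matrix: dyadic upper bounds (margin ≈ 0.4 %) of
`C_k (P + Cᵀ·diag(λa)·C)⁻¹ C_kᵀ` on the six active channels; `1` on the three diagonal channels (`C_k = 0`). -/
def sVQ : Fin 9 → ℚ := ![1, 4833/2048, 1269/512, 4833/2048, 1, 9709/4096, 1269/512, 9709/4096, 1]

/-- `s_k` on the typed channel index. -/
def sVK (k : Fin 3 × Fin 3) : ℚ := sVQ (eκ k)

/-- The enlarged level `cVLQ = 7290583/2³⁰ ≈ 6.790·10⁻³` (largest `2⁻³⁰`-multiple with `c·s_k < γ_lo²` on all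
nine channels, `γ_lo = 64863/500000`). -/
def cVLQ : ℚ := (7290583 : ℚ) / 1073741824

/-- **The LOWER comparison matrix over `ℚ`** on the state type: `L = P + Cᵀ·diag(λ_k a_k)·C`. -/
def LloVQ : Matrix (Fin 3 ⊕ Fin 2) (Fin 3 ⊕ Fin 2) ℚ :=
  PQ + CQᵀ * Matrix.diagonal (fun k => lamK k * aK k) * CQ

/-! ### Kernel decisions -/

set_option maxHeartbeats 4000000 in
/-- **The nine rank-one facts against the lower matrix**: `s_k·L − C_kᵀC_k ⪰ 0` (5 × 5 `LDLᵀ` each, decided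
in the kernel; on the diagonal channels this is `L ⪰ 0`). -/
theorem rkV_ldl : ∀ k : Fin 3 × Fin 3, PSD.LDLCert ((sVK k • LloVQ - Matrix.vecMulVec (CQ k) (CQ k)).submatrix
    e1.symm e1.symm) := by
  decide +kernel

/-- The level tests: `s_k > 0` and `cVLQ·s_k < γ_lo²` on every channel. -/
theorem levelV_tests : (∀ k : Fin 3 × Fin 3, 0 < sVK k) ∧ ∀ k : Fin 3 × Fin 3, cVLQ * sVK k < gammaLoQ ^ 2 := by
  constructor <;> decide +kernel

/-- **The level ratio of record** (kernel): `cVLQ` exceeds `8 ×` ★ #35's rank-one level `c_rk = cQ`. -/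
theorem levelV_ratio : (8 : ℚ) < cVLQ / cQ := by norm_num [cVLQ, cQ]

/-! ### Cast plumbing -/

/-- `(M·N) ↦ ℝ` (plumbing). -/
private theorem map_mul' {m n o : Type*} [Fintype n] (M : Matrix m n ℚ) (N : Matrix n o ℚ) :
    (M * N).map (Rat.cast : ℚ → ℝ) = M.map (Rat.cast : ℚ → ℝ) * N.map (Rat.cast : ℚ → ℝ) :=
  Matrix.map_mul (f := Rat.castHom ℝ)
/-- `(M+N) ↦ ℝ` (plumbing). -/
private theorem map_add' {m n : Type*} (M N : Matrix m n ℚ) :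
    (M + N).map (Rat.cast : ℚ → ℝ) = M.map (Rat.cast : ℚ → ℝ) + N.map (Rat.cast : ℚ → ℝ) := by
  ext i j; simp
/-- `(M−N) ↦ ℝ` (plumbing). -/
private theorem map_sub' {m n : Type*} (M N : Matrix m n ℚ) :
    (M - N).map (Rat.cast : ℚ → ℝ) = M.map (Rat.cast : ℚ → ℝ) - N.map (Rat.cast : ℚ → ℝ) := by
  ext i j; simp
/-- transpose commutes with the cast (plumbing). -/
private theorem map_transpose' {m n : Type*} (M : Matrix m n ℚ) :
    Mᵀ.map (Rat.cast : ℚ → ℝ) = (M.map (Rat.cast : ℚ → ℝ))ᵀ := rfl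
/-- `diag(d) ↦ ℝ` (plumbing). -/
private theorem map_diagonal' {n : Type*} [DecidableEq n] (d : n → ℚ) :
    (Matrix.diagonal d).map (Rat.cast : ℚ → ℝ) = Matrix.diagonal (fun i => (d i : ℝ)) :=
  Matrix.diagonal_map Rat.cast_zero
/-- `(q • M) ↦ ℝ` (plumbing). -/
private theorem map_smul' {m n : Type*} (q : ℚ) (M : Matrix m n ℚ) :
    (q • M).map (Rat.cast : ℚ → ℝ) = (q : ℝ) • M.map (Rat.cast : ℚ → ℝ) := by
  ext i j; simp
/-- `vecMulVec` commutes with the cast (plumbing). -/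
private theorem map_vecMulVec' {m n : Type*} (u : m → ℚ) (v : n → ℚ) :
    (Matrix.vecMulVec u v).map (Rat.cast : ℚ → ℝ)
      = Matrix.vecMulVec (fun i => (u i : ℝ)) (fun j => (v j : ℝ)) := by
  ext i j; simp [Matrix.vecMulVec]

/-- **The certificate's LOWER comparison matrix IS `LloVQ ↦ ℝ`** (`cert.toLP.lowerMatrix = P + Cᵀ·diag(λa)·C`
by `SlabCertificate.toLP_lowerMatrix`, then casts). -/
theorem lowerMatrix_eq_LloVQ : cert.toLP.lowerMatrix = LloVQ.map (Rat.cast : ℚ → ℝ) := by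
  have hd : Matrix.diagonal (fun k => cert.lam k * cert.a k)
      = (Matrix.diagonal (fun k => lamK k * aK k)).map (Rat.cast : ℚ → ℝ) := by
    rw [map_diagonal', cert_lam, cert_a]; congr 1; funext k; simp only [lam, a]; push_cast; ring
  rw [SlabCertificate.toLP_lowerMatrix, hd, cert_P, C_eq, P, LloVQ]
  simp only [map_add', map_mul', map_transpose']

/-- A channel row of `C` over `ℝ` is the cast of the `ℚ` row (plumbing). -/
private theorem C_row_cast (k : Fin 3 × Fin 3) : WSCC9.lurieSystem.C k = fun i => ((CQ k i : ℚ) : ℝ) := by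
  funext i
  rw [C_eq]
  rfl

/-- **The nine rank-one facts over `ℝ` against the certificate's lower matrix.** -/
theorem lowerV_rankOne (k : Fin 3 × Fin 3) :
    (((sVK k : ℚ) : ℝ) • cert.toLP.lowerMatrix
      - Matrix.vecMulVec (WSCC9.lurieSystem.C k) (WSCC9.lurieSystem.C k)).PosSemidef := by
  have hq : ((sVK k : ℚ) : ℝ) • cert.toLP.lowerMatrix
      - Matrix.vecMulVec (WSCC9.lurieSystem.C k) (WSCC9.lurieSystem.C k)
      = (sVK k • LloVQ - Matrix.vecMulVec (CQ k) (CQ k)).map (Rat.cast : ℚ → ℝ) := by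
    rw [lowerMatrix_eq_LloVQ, C_row_cast, map_sub', map_smul', map_vecMulVec']
  rw [hq]
  have h := ((rkV_ldl k).posSemidef (R := ℝ)).submatrix e1
  have e2 : (((sVK k • LloVQ - Matrix.vecMulVec (CQ k) (CQ k)).submatrix ⇑e1.symm ⇑e1.symm).map
      (Rat.cast : ℚ → ℝ)).submatrix e1 e1
      = (sVK k • LloVQ - Matrix.vecMulVec (CQ k) (CQ k)).map (Rat.cast : ℚ → ℝ) := by
    ext i j; simp
  rwa [e2] at h

/-! ### The face hypothesis at the enlarged level, and ★ #35's sentence at that level -/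

/-- **The face hypothesis `hfr` at level `cVLQ`**: `cVLQ < V` on the frontier of the slab
`|σ_k − δ*_k| < γ = 2·arctan(13/200)` — lit-6's `LPSlabCertificate.lt_V_of_mem_frontier_slab` applied to
`cert.toLP` with the lower rank-one facts, the decided tests `cVLQ·s_k < γ_lo²` and `γ_lo < γ`. -/
theorem hfrVL : ∀ x ∈ frontier (WSCC9.lurieSystem.slab (fun _ => γ)),
    ((cVLQ : ℚ) : ℝ) < cert.V x := by
  intro x hx
  have hs0 : ∀ k : Fin 3 × Fin 3, (0 : ℝ) < ((sVK k : ℚ) : ℝ) := fun k => by exact_mod_cast levelV_tests.1 k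
  have h0 : (0 : ℝ) ≤ ((gammaLoQ : ℚ) : ℝ) := by exact_mod_cast gammaLo_test.1
  have hsq : ((gammaLoQ : ℚ) : ℝ) ^ 2 < γ ^ 2 :=
    pow_lt_pow_left₀ gammaLo_lt_γ h0 two_ne_zero
  have hc' : ∀ k : Fin 3 × Fin 3, ((cVLQ : ℚ) : ℝ) < γ ^ 2 / ((sVK k : ℚ) : ℝ) := by
    intro k
    rw [lt_div_iff₀ (hs0 k)]
    have h1 : ((cVLQ : ℚ) : ℝ) * ((sVK k : ℚ) : ℝ) < ((gammaLoQ : ℚ) : ℝ) ^ 2 := by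
      exact_mod_cast levelV_tests.2 k
    exact h1.trans hsq
  have h := cert.toLP.lt_V_of_mem_frontier_slab (γ := fun _ => γ)
    hsec hs0 lowerV_rankOne hc' hx
  rwa [SlabCertificate.toLP_V] at h

/-- **«#35-LEVEL+ (LP)» — ★ #35 «G2.c-WSCC9-LOSSY-SLAB» (lane V)'s certified region at the ENLARGED level
`cVLQ = 7290583/2³⁰`.** MODEL M′ = `WSCC9.postB_SPdamp.toModel` (WSCC9 post-fault-B classical model, Kron reduction WITH
transfer conductances as printed h12, printed damping `D/M = 1/10, 1/5, 3/10`), read in Pai's directed Lur'e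
presentation `WSCC9.lurieSystem`; CLASS C′ = ★ #35's slab + Popov certificate `WSCC9LossySlab.cert` (SAME `V`).
STATEMENT: for every solution `c` of M′ on `univ` whose Lur'e state `x = (ω | σ − σ*)` starts in the slab
`|σ_k − δ*_k| < γ = 2·arctan(13/200)` (all nine directed channels) with `V(x(0)) ≤ cVLQ`: the slab and the level are
kept for all `t ≥ 0` and `x(t) → 0` — every speed deviation `→ 0` and every relative rotor angle `→` its post-fault
equilibrium value. Inner estimate (8.57× the level of ★ #35 on the SAME certificate); a priori over all solutions.
No sentence here says a grid is stable.
[cite: Khalil2002, §7.1.2 Theorem 7.3 with §7.1 Example 7.5; Pai1981, §2.16 Theorem [18] eqs. (2.63)–(2.64) and §4.6 eq. (4.46); VuTuritsyn2017, §4.3 Theorem 1 with eq. (V_min)] -/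
theorem lossy_slab_roa_levelVL {c : ℝ → ClassicalSwing.State 3}
    (hc : WSCC9.postB_SPdamp.toModel.IsSolutionOn c univ)
    (h0 : WSCC9.postB_SPdamp.lurieState WSCC9.postB_SPdamp.angleOf (c 0)
      ∈ WSCC9.lurieSystem.slab (fun _ => γ))
    (h0c : cert.V (WSCC9.postB_SPdamp.lurieState WSCC9.postB_SPdamp.angleOf (c 0)) ≤ ((cVLQ : ℚ) : ℝ)) :
    (∀ t, 0 ≤ t →
        WSCC9.postB_SPdamp.lurieState WSCC9.postB_SPdamp.angleOf (c t)
            ∈ WSCC9.lurieSystem.slab (fun _ => γ) ∧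
          cert.V (WSCC9.postB_SPdamp.lurieState WSCC9.postB_SPdamp.angleOf (c t)) ≤ ((cVLQ : ℚ) : ℝ)) ∧
      Tendsto (fun t => WSCC9.postB_SPdamp.lurieState WSCC9.postB_SPdamp.angleOf (c t)) atTop (𝓝 0) := by
  have key := cert.well_subset_regionOfAttraction (γ := fun _ => γ)
    hsec hfrVL h0 h0c
  exact key.2 (fun t => WSCC9.postB_SPdamp.lurieState WSCC9.postB_SPdamp.angleOf (c t)) rfl
    fun T t ht => WSCC9.hasDerivWithinAt_lurieState hc t

end Summit.Ventures.GridStability.Lyapunov.WSCC9LossySlab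

end
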